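/-
Copyright: the b2b-balaban cell (near-miss cell 7), T⁴-continuum fan-out, lineage t4-ne7b-p3 (node U5c LARGE-DEVIATION
member P3).  Released under the licence of the surrounding project.
-/
import Summits.QuantumFields.BalabanUV.T4Continuum.Support.SpaceTimeBankedRate
import Summits.QuantumFields.BalabanUV.T4Continuum.Support.SpaceTimeVolume
import Summits.QuantumFields.BalabanUV.T4Continuum.Support.HistoryBankingLEInduction

/-!
# Space-time Peierls ∕ Cramér route for NE7b — THE BANKED RATE WITHOUT THE RENEWAL-AT-REACH CLAUSE (LE road):
# the per-cell surplus of a lineage from the COUNT swarm's `bankedLE_induction` on `ConsistentTLE id`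

Summits-side support leaf of the T⁴-continuum cell (rung (B)+1 on a FINITE torus only; NOT infinite volume, NOT the
mass gap, NOT the Clay statement; NOT a proof of the spine estimate NE7b).  Lineage `t4-ne7b-p3` (generation 3), node
U5c, skeleton `t4/skeletons/NE7b-t4-ne7b-p3.md` §13 (the LE road of the CONTOUR route).  [folklore] bookkeeping over
this lineage's `SpaceTimeBankedRate` (`rateB`, `BankedSurplus`, `surplus_ge_rateB_mul_vol`, `sum_margin_ge`),
`SpaceTimeVolume` (`volumeAccounting_ledgerOfGen`), `SpaceTimeLifetime` (`StepsOK`), and the COUNT swarm's row-S4c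
modules `HistoryBankingLE` ∕ `HistoryBankingLEInduction` (p-landed: `ConsistentTLE`, **`bankedLE_induction`** — the
banked induction on the TOTAL booked cost, renewal clause `h + 1 ≤ reach`), `LateMergers.FreshT.of_wf`,
`Lit.T4TaggedShapeBanking.{dictWT_id, costT_id}` — all BY NAME; nothing printed is asserted; no `[cite:]` tag.

WHY.  The factor half of leaf A3 (§2 of the skeleton) priced a lineage by `SpaceTimeBankedRate.surplus_ge_rateB_printedShape`,
whose admissibility is the landed `T4PrintedShapeBanking.Consistent` — renewal AT the booked reach (`h + 1 = reach`).  On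
the COUNT carrier that clause is the displayed finding F-1(c) (`HistoryAdmissible.PGen.RenewAtReach`: print renews at
physical readiness, which may PRECEDE the booked bound; `HistoryRealise.renew_lt_reach` proves only `h + 1 ≤ reach`).  The
COUNT swarm's LE road (`HistoryBankingLE`, ruling R-OWNER-22-6) re-ran the banked induction with the clause weakened to
`h + 1 ≤ reach` (`ConsistentTLE`), which `HistoryRealise.consistentTLE_toGen_of_realises` DERIVES from the geometry.  THIS
FILE ports the factor half of the CONTOUR route to that road, so that `RenewAtReach` disappears from the route's residue.

WHAT.
* §1 `stepsOK_of_consistentTLE`, `volumeAccounting_of_consistentTLE`: the located side conditions of the volume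
  accounting (renewal after the root birth and no later than the reach; mergers inside both lives) hold under
  `ConsistentTLE id ∧ Gen.WF` — so A3b's tree form is unchanged on the LE road.
* §2 `bankedSurplus_of_bound` (carrier): the banked surplus of `ledgerOfGen` from the INEQUALITY
  `lifeCost + banks(κ₁W + E) ≤ credits` (margins `E ≥ 0`, birth shape `E b ≥ Eb + μ·fat b` on admissible births) — the
  conclusion shape of either banked induction; `surplus_ge_rateB_of_bound`.
* §3 **`surplus_ge_rateB_LE`**: on the dictionary with `ConsistentTLE id C K R G`, `G.WF (dictW R C.n₁)`, valid
  constants, `0 ≤ A₀`, a nonnegative profile, (2.9), `L ≥ 1`, sizes `R ≥ 1` and the three scale-indexed PAY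
  INEQUALITIES of the COUNT member (birth ∕ renewal ∕ merger — `Lit.T4TaggedShapeBanking.exists_payThreshold` puts them
  past one infrared threshold along the typed flow), the volume accounting gives
  `rateB κ₁ Eb μ C₁ C₂ · vol ≤ credits − lifeCost`.  NO `RenewAtReach`, no `Banking` structure.

HONEST DEPENDENCY (cell, verbatim): continuum YM on T⁴ ⇐ BetaPertH ∧ nine spine estimates (0/9 proved); BetaPertH ⇐
(D1) ∧ (D4) ∧ CAP+tail; G-an2-4 gates asym, D1 and NE2/3/4.  This file changes none of it.
-/

open Finset

namespace Summit.QuantumFields.BalabanUV.T4Continuum.SpaceTimePeierls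

open Literature.MathematicalPhysics.QuantumFieldTheory.Balaban1983to89
open T4PersistenceDictionary T4BankedInduction T4TaggedShapeBanking SpaceTimePeierlsLeaves
open Summit.QuantumFields.BalabanUV.T4Continuum.HistoryBankingLE
open Summit.QuantumFields.BalabanUV.T4Continuum.HistoryBankingLEInduction (bankedLE_induction)

noncomputable section

/-! ## §1 The located side conditions of the volume accounting on the LE road -/

section Steps

open T4PrintedShapeBanking

variable {C : T4PrintedShapeBanking.Consts} {K : ℕ} {R : ℕ → ℕ}

/-- **`StepsOK` FROM `ConsistentTLE id ∧ Gen.WF`**: a renewal happens after the root birth (`Gen.WF`) and the renewed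
component appears no later than the old reach (`ConsistentTLE`'s `h + 1 ≤ reach`); a merger step lies in both
partners' booked lives. [folklore] -/
theorem stepsOK_of_consistentTLE :
    ∀ {G : Gen PEv}, ConsistentTLE id C K R G → G.WF (dictW R C.n₁) → StepsOK PEv.step (dictW R C.n₁) G
  | Gen.born _ _, _, _ => trivial
  | Gen.renew G e h, hc, hW => by
      simp only [ConsistentTLE] at hc
      obtain ⟨hG, -, -, hr, -⟩ := hc
      simp only [Gen.WF] at hW
      obtain ⟨hGW, -, hh, -⟩ := hW
      exact ⟨stepsOK_of_consistentTLE hG hGW, hh, hr⟩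
  | Gen.merge X Y e, hc, hW => by
      simp only [ConsistentTLE] at hc
      obtain ⟨hX, hY, -, hx, hx', hy, hy', -⟩ := hc
      simp only [Gen.WF] at hW
      obtain ⟨hXW, hYW, -⟩ := hW
      exact ⟨stepsOK_of_consistentTLE hX hXW, stepsOK_of_consistentTLE hY hYW, hx, hx', hy, hy'⟩

/-- **THE VOLUME ACCOUNTING ON THE LE ROAD** (`SpaceTimeVolume.volumeAccounting_ledgerOfGen` with the side conditions
from `ConsistentTLE id ∧ Gen.WF`): a cut `t ≤ reach` and the cell binder
`vol ≤ cA·treeD G t + cB·treeSteps G t` give `VolumeAccounting (2cA) (cB + 2cA·dC)` of `ledgerOfGen`. [folklore] -/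
theorem volumeAccounting_of_consistentTLE {cost : Gen PEv → ℕ → ℝ} {credit : PEv → ℝ} {cA cB dC : ℝ}
    (hcA : 0 ≤ cA) (hcB : 0 ≤ cB) (hdC : 0 ≤ dC) {G : Gen PEv} (hc : ConsistentTLE id C K R G)
    (hW : G.WF (dictW R C.n₁)) {t : ℕ} (ht : t ≤ G.reach (dictW R C.n₁)) {vol : ℕ}
    (hvol : (vol : ℝ) ≤ cA * treeD PEv.fat PEv.step dC G t + cB * treeSteps PEv.step G t) :
    (ledgerOfGen (dictW R C.n₁) cost credit vol (fatSum PEv.fat G) G).VolumeAccounting (2 * cA)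
      (cB + 2 * cA * dC) :=
  volumeAccounting_ledgerOfGen hcA hcB hdC (stepsOK_of_consistentTLE hc hW) hW ht hvol

end Steps

/-! ## §2 The banked surplus from the conclusion of a banked induction -/

section Carrier

variable {ε : Type*} [DecidableEq ε]

/-- **THE BANKED SURPLUS FROM THE BOUND `lifeCost + banks ≤ credits`.**  For an admissibility predicate closed under
taking the renewed ∕ merged parts, margins `E ≥ 0` with the birth shape `E b ≥ Eb + μ·fat b` on admissible births, an
admissible well-formed genealogy with `lifeCost + banks(κ₁·W + E) ≤ credits` has the banked surplus
`κ₁·epochLen + Eb·births + μ·fat ≤ credits − lifeCost` on `ledgerOfGen` (fat `:= fatSum`). [folklore] -/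
theorem bankedSurplus_of_bound {adm : Gen ε → Prop} {W : ε → ℕ} {cost : Gen ε → ℕ → ℝ} {credit E : ε → ℝ}
    {fat : ε → ℕ} {κ₁ Eb μ : ℝ}
    (adm_renew : ∀ G e h, adm (Gen.renew G e h) → adm G)
    (adm_merge : ∀ X Y e, adm (Gen.merge X Y e) → adm X ∧ adm Y)
    (hE0 : ∀ e, 0 ≤ E e) (hEb : ∀ b j, adm (Gen.born b j) → Eb + μ * fat b ≤ E b)
    {G : Gen ε} (hA : adm G) (hG : G.WF W)
    (hle : lifeCost W cost G + banks (fun e => κ₁ * (W e : ℝ) + E e) G ≤ credits credit G) (vol : ℕ) :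
    (ledgerOfGen W cost credit vol (fatSum fat G) G).BankedSurplus κ₁ Eb μ := by
  have h2 := sum_margin_ge (W := W) adm_renew adm_merge hE0 hEb G hA hG
  have hb : banks (fun e => κ₁ * (W e : ℝ) + E e) G =
      κ₁ * (((∑ e ∈ G.events, W e : ℕ)) : ℝ) + ∑ e ∈ G.events, E e := by
    simp only [banks, sum_add_distrib, ← mul_sum, Nat.cast_sum]
  rw [hb] at hle
  show κ₁ * (((∑ e ∈ G.events, W e : ℕ)) : ℝ) + Eb * ((nBirths G : ℕ) : ℝ) + μ * ((fatSum fat G : ℕ) : ℝ)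
      ≤ credits credit G - lifeCost W cost G
  linarith

/-- Hence the per-cell rate: with the volume accounting `VolumeAccounting C₁ C₂`,
`rateB κ₁ Eb μ C₁ C₂ · vol ≤ credits − lifeCost`. [folklore] -/
theorem surplus_ge_rateB_of_bound {adm : Gen ε → Prop} {W : ε → ℕ} {cost : Gen ε → ℕ → ℝ} {credit E : ε → ℝ}
    {fat : ε → ℕ} {κ₁ Eb μ C₁ C₂ : ℝ}
    (adm_renew : ∀ G e h, adm (Gen.renew G e h) → adm G)
    (adm_merge : ∀ X Y e, adm (Gen.merge X Y e) → adm X ∧ adm Y)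
    (hE0 : ∀ e, 0 ≤ E e) (hEb : ∀ b j, adm (Gen.born b j) → Eb + μ * fat b ≤ E b)
    (hκ : 0 ≤ κ₁) (hEb0 : 0 ≤ Eb) (hμ : 0 ≤ μ) (hC₁ : 0 < C₁) (hC₂ : 0 < C₂)
    {G : Gen ε} (hA : adm G) (hG : G.WF W)
    (hle : lifeCost W cost G + banks (fun e => κ₁ * (W e : ℝ) + E e) G ≤ credits credit G) {vol : ℕ}
    (hvol : (ledgerOfGen W cost credit vol (fatSum fat G) G).VolumeAccounting C₁ C₂) :
    rateB κ₁ Eb μ C₁ C₂ * vol ≤ credits credit G - lifeCost W cost G :=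
  (ledgerOfGen W cost credit vol (fatSum fat G) G).surplus_ge_rateB_mul_vol hC₁ hC₂ hκ hEb0 hμ hvol
    (bankedSurplus_of_bound adm_renew adm_merge hE0 hEb hA hG hle vol)

end Carrier

/-! ## §3 The printed-shape instance on the LE road -/

section Printed

open T4PrintedShapeBanking

variable {C : T4PrintedShapeBanking.Consts} {K : ℕ} {R : ℕ → ℕ} {g : ℕ → ℝ} {L : ℕ} {β' β₀ : ℝ}

/-- The root birth of an LE-consistent genealogy happens at a performed step: `rootStep ≤ K`. [folklore] -/
theorem rootStep_le_of_consistentTLE {G : Gen PEv} (hc : ConsistentTLE id C K R G) : G.rootStep ≤ K := by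
  have h := ConsistentTLE.step_le hc G.root G.root_mem
  rw [(ConsistentTLE.root_spec hc).2] at h
  exact h

/-- **THE PRINTED-SHAPE INSTANCE ON THE LE ROAD.**  On the dictionary (windows `dictW R C.n₁`, costs `cost C K R`,
credits `credit C g`, bank `κ₁·W + Emarg C`, reserves `reserve C g`) with the admissibility `ConsistentTLE id C K R`
(renewal no later than the booked reach) and `Gen.WF`: valid constants, (2.9) along the run, `L ≥ 1`, sizes `R ≥ 1`,
the COUNT member's three PAY INEQUALITIES at the cutoff `K` (birth, renewal, merger — displayed here; past one
infrared threshold by `exists_payThreshold`), `0 ≤ A₀`, a nonnegative profile on performed steps and the volume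
accounting A3b give `rateB C.κ₁ C.Eb C.μ C₁ C₂ · vol ≤ credits − lifeCost` — by the COUNT swarm's
`bankedLE_induction` (total booked cost), read at the flat shape `id` (`dictWT_id`, `costT_id`). [folklore] -/
theorem surplus_ge_rateB_LE (hC : C.Valid) (h29 : B14FlowStep.FlowIneq29 R g L β' β₀ K) (hL : 1 ≤ L)
    (hR1 : ∀ s, s ≤ K → 1 ≤ R s)
    (Hb : ∀ s, s ≤ K → ∀ d' : ℕ,
      (C.Eb + C.μ + (3 * C.E₂ * (L : ℝ) ^ C.q' + C.E₃ * (L : ℝ) ^ C.q' + 3 * C.κ₁) * (R s : ℝ) ^ (C.q' + 1)) *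
          ((d' : ℝ) + 1) + 2 * p0Profile C.A₀ C.p₀ (g s) ≤
        C.a * (p0Profile C.A₀ C.p₀ (g s)) ^ 2 * ((d' : ℝ) + 1) + 2 * p0Profile C.A₀ C.p₀ (g s))
    (Hr : ∀ h, h + 1 ≤ K →
      2 * C.E₂ * (L : ℝ) ^ C.q' * (R (h + 1) : ℝ) ^ (C.q' + 1) + (C.κ₁ * ((R (h + 1) : ℝ) + 1) + C.E₀) ≤
        p0Profile C.A₀ C.p₀ (g h))
    (Hm : ∀ m s, m ≤ s → s ≤ K →
      ((1 + C.n₁) * C.E₂ * (L : ℝ) ^ C.q' + C.dC * C.E₃ * (L : ℝ) ^ C.q') * (R s : ℝ) ^ (C.q' + 1) +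
          (C.κ₁ * ((C.n₁ : ℝ) + R s) + C.E₀) ≤ 2 * p0Profile C.A₀ C.p₀ (g m))
    (hA0 : 0 ≤ C.A₀) (hx0 : ∀ s, s ≤ K → 0 ≤ Real.log ((g s) ^ 2)⁻¹) {C₁ C₂ : ℝ} (hC₁ : 0 < C₁) (hC₂ : 0 < C₂)
    {G : Gen PEv} (hc : ConsistentTLE id C K R G) (hW : G.WF (dictW R C.n₁)) {vol : ℕ}
    (hvol : (ledgerOfGen (dictW R C.n₁) (cost C K R) (credit C g) vol (fatSum PEv.fat G) G).VolumeAccounting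
      C₁ C₂) :
    rateB C.κ₁ C.Eb C.μ C₁ C₂ * vol ≤ credits (credit C g) G - lifeCost (dictW R C.n₁) (cost C K R) G := by
  -- the COUNT swarm's LE banked induction, at the flat shape
  have hind := bankedLE_induction hC h29 hL hR1 Hb Hr Hm hc (LateMergers.FreshT.of_wf _ hW)
  have hind' : lifeCost (dictW R C.n₁) (cost C K R) G +
      banks (fun e => C.κ₁ * ((dictW R C.n₁ e : ℕ) : ℝ) + Emarg C e) G + reserve C g G.root ≤
        credits (credit C g) G := hind
  -- the root reserve `2p₀(g_{rootStep})` is nonnegative (`rootStep ≤ K`)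
  have hroot := ConsistentTLE.root_spec hc
  have hk : G.root.kind = 0 := hroot.1
  have hs : G.root.step = G.rootStep := hroot.2
  have hres : 0 ≤ reserve C g G.root := by
    rw [reserve_kind0 hk, hs]
    unfold p0Profile
    exact mul_nonneg (by norm_num) (mul_nonneg hA0 (pow_nonneg (hx0 _ (rootStep_le_of_consistentTLE hc)) _))
  have hle : lifeCost (dictW R C.n₁) (cost C K R) G +
      banks (fun e => C.κ₁ * ((dictW R C.n₁ e : ℕ) : ℝ) + Emarg C e) G ≤ credits (credit C g) G := by
    linarith
  refine surplus_ge_rateB_of_bound (adm := ConsistentTLE (id : PEv → PEv) C K R) (fat := PEv.fat)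
    (fun G e h hA => hA.1) (fun X Y e hA => ⟨hA.1, hA.2.1⟩) ?_ ?_ hC.κ₁_nonneg hC.Eb_nonneg hC.μ_nonneg hC₁ hC₂
    hc hW hle hvol
  · -- margins are nonnegative
    intro e
    by_cases h : e.kind = 0
    · rw [Emarg_kind0 h]
      have := hC.Eb_nonneg
      have := hC.μ_nonneg
      positivity
    · unfold Emarg
      rw [if_neg h]
      exact hC.E₀_nonneg
  · -- births: kind `0`, margin `Eb + μ(d′+1) ≥ Eb + μ d′`
    intro b j hb
    have hk : b.kind = 0 := hb.1
    rw [Emarg_kind0 hk]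
    nlinarith [hC.μ_nonneg]

end Printed

end

end Summit.QuantumFields.BalabanUV.T4Continuum.SpaceTimePeierls
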